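import Mathlib
import Summits.KontsevichZagierPeriods.KontsevichZagierPeriods.Theses.InverseLandau
import Literature.NumberTheory.Transcendental.KZCalculus
import Literature.NumberTheory.Transcendental.KZLogCalculusProofs
import Literature.NumberTheory.Transcendental.KZProduct
import Summits.KontsevichZagierPeriods.KontsevichZagierPeriods.Theorems.BetaCancellation.Negative.PiLink

/-!
# `TateLifting` (stmt-KontsevichZagierPeriods-9129), line `Sketch` — stub `tateLifting_betaHalfPi`

`[β(1/2,1/2)] ∼ [closed unit disc, 1]` inside the Kontsevich–Zagier move calculus: every
one-dimensional integral representation `β` with domain `(0,1) ⊆ ℝ¹` and integrand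
`t^{-1/2} (1 − t)^{-1/2}` on it is `KZ.Equivalent` to every two-dimensional representation `δ`
with domain the closed unit disc `{x² + y² ≤ 1}` and integrand `1` on it (the value identity is
`B(1/2,1/2) = Γ(1/2)² = π`). This is verbatim the item `BetaHalfPi`
(stmt-KontsevichZagierPeriods-11053) of route KatzTower.

## Proof

Packaging of the tree theorem
`BetaCancellationNegative.equivalent_betaHalfRep_piRep : KZ.Equivalent betaHalfRep KZ.piRep`
(`Theorems/BetaCancellation/Negative/PiLink.lean`: the affine substitution `t = (1 + x)/2`,
Kontsevich–Zagier's step `∫ dx/√(1−x²) = ∫ 2√(1−x²) dx`, and the disc as the band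
`|y| ≤ √(1−x²)`, four moves in all):

* `β ∼ betaHalfRep` by congruence (`KZ.of_sub_of_mem_relations_of_eqOn`): both have domain
  `KZreg.unitIoo = {t | 0 < t 0 ∧ t 0 < 1}` and on it `betaHalfRep.integrand t =
  betaKernel (1/2) (1/2) (t 0) = (t 0)^{1/2 − 1} (1 − t 0)^{1/2 − 1}` agrees with `β.integrand`;
* `betaHalfRep ∼ KZ.piRep` (`equivalent_betaHalfRep_piRep`);
* `KZ.piRep ∼ δ` by congruence again (`KZ.piRep = [KZ.piDisc, 1]`,
  `KZ.piDisc = {x | x 0 ^ 2 + x 1 ^ 2 ≤ 1}`).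

Reference: M. Kontsevich, D. Zagier, *Periods* (2001), §1.1 eq. (1) and §1.2.
-/

noncomputable section

namespace Summit.KontsevichZagierPeriods.InverseLandau

open MeasureTheory Set
open Literature.NumberTheory.Transcendental
open Summit.KontsevichZagierPeriods.KontsevichZagierPeriods.BetaCancellationNegative
  (betaHalfRep betaHalfRep_domain betaHalfRep_integrand betaKernel equivalent_betaHalfRep_piRep)

/-- **`β ∼ [β(1/2,1/2)]`**: a one-dimensional representation with domain `(0,1)` and integrand
`t^{-1/2} (1 − t)^{-1/2}` on it is congruent to `betaHalfRep` (same domain, integrands agree on it;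
integrand additivity with a zero representation). [cite: KontsevichZagier2001, §1.2] -/
theorem equivalent_betaHalfRep_of_eqOn (β : KZ.IntegralRep 1)
    (hd : β.domain = {v : Fin 1 → ℝ | v 0 ∈ Set.Ioo (0:ℝ) 1})
    (hi : Set.EqOn β.integrand (fun v => (v 0) ^ (-(1:ℝ)/2) * (1 - v 0) ^ (-(1:ℝ)/2)) β.domain) :
    KZ.Equivalent β betaHalfRep := by
  refine KZ.of_sub_of_mem_relations_of_eqOn (by rw [hd, betaHalfRep_domain]; rfl) fun v hv => ?_
  rw [hi hv, betaHalfRep_integrand]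
  have he : ((1 / 2 : ℚ) : ℝ) - 1 = -(1:ℝ) / 2 := by norm_num
  simp only [betaKernel, he]

/-- **`[π] ∼ δ`**: a two-dimensional representation with domain the closed unit disc and
integrand `1` on it is congruent to `KZ.piRep = [{x² + y² ≤ 1}, 1]`.
[cite: KontsevichZagier2001, §1.1 eq. (1)] -/
theorem equivalent_piRep_of_eqOn (δ : KZ.IntegralRep 2)
    (hd : δ.domain = {x : Fin 2 → ℝ | x 0 ^ 2 + x 1 ^ 2 ≤ 1})
    (hi : Set.EqOn δ.integrand (fun _ => (1:ℝ)) δ.domain) :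
    KZ.Equivalent KZ.piRep δ := by
  have hd' : δ.domain = KZ.piRep.domain := by rw [hd, KZ.piRep_domain]; rfl
  refine KZ.of_sub_of_mem_relations_of_eqOn hd' fun x hx => ?_
  rw [KZ.piRep_integrand, hi (hd' ▸ hx)]

/-- **`[β(1/2,1/2)] ∼ [closed unit disc, 1]`** (stub `tateLifting_betaHalfPi` of the line `Sketch`
of the crux `TateLifting`, stmt-KontsevichZagierPeriods-9129; verbatim the item `BetaHalfPi`,
stmt-KontsevichZagierPeriods-11053, of route KatzTower): `B(1/2,1/2) = π` inside the four moves.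
Chain `β ∼ betaHalfRep ∼ KZ.piRep ∼ δ`: two congruences around the tree theorem
`equivalent_betaHalfRep_piRep`. [cite: KontsevichZagier2001, §1.1 eq. (1)] -/
theorem tateLifting_betaHalfPi :
    ∀ (β : KZ.IntegralRep 1) (δ : KZ.IntegralRep 2), β.domain = {v : Fin 1 → ℝ | v 0 ∈ Set.Ioo (0:ℝ) 1} → Set.EqOn β.integrand (fun v => (v 0) ^ (-(1:ℝ)/2) * (1 - v 0) ^ (-(1:ℝ)/2)) β.domain → δ.domain = {x : Fin 2 → ℝ | x 0 ^ 2 + x 1 ^ 2 ≤ 1} → Set.EqOn δ.integrand (fun _ => (1:ℝ)) δ.domain → KZ.Equivalent β δ :=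
  fun β δ hβd hβi hδd hδi =>
    ((equivalent_betaHalfRep_of_eqOn β hβd hβi).trans equivalent_betaHalfRep_piRep).trans
      (equivalent_piRep_of_eqOn δ hδd hδi)

end Summit.KontsevichZagierPeriods.InverseLandau

end
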